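import Literature.Algebra.EuclideanLattices.FarCertMachineCodes
import Literature.LinearAlgebra.Matrix.FaddeevLeVerrier
import HarnessLib

/-!
# The adjugate and the determinant of an integer matrix in `FP`: the Faddeev–LeVerrier machine

Topic `Algebra/EuclideanLattices` (family `pqc`), machine-level toolkit in the `FP` string algebra of
`LLLMachineTables.lean` (`rowCode`/`matCode`, `dotF`) and `FarCertMachineCodes.lean` (`idxList`,
`iotaF`, maps over index lists). Reductions between lattice problems that must hand an INTEGER basis
of (a scaling of) the dual lattice `L(B)* = B⁻¹ℤⁿ` to an oracle — Regev's `GapCVP′ → DGS` reduction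
(Regev 2009, Lemma 3.20: "call the DGS oracle with the lattice `L*`"), the `BDD`/`CVP` steps of the
`LWE` reductions — need `adj B` and `det B` computed in polynomial time from the code of `B`
(`det B · (B⁻¹)ᵀ = (adj B)ᵀ` generates `det B · L*`, `RegevDualQuery.lean`). This file realises the
**Faddeev–LeVerrier recursion** (`LinearAlgebra/Matrix/FaddeevLeVerrier.lean`:
`N_l = B N_{l+1} + c_{l+1} 1`, `(n − l) c_l = −tr(B N_l)`, `N_n = 0`, `c_n = 1`, ending with
`N_0 = adj(−B)`, `c_0 = det(−B)`) as a total string function: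

* `prodEntry`, `prodRowF`, `stepTF` — one recursion step on codes: from `⟨c, T⟩`, `T = matCode N_{l+1}ᵀ`,
  the code of `N_lᵀ`, entry `(k, i) ↦ capZ_W (row_k(T) · row_i(B) + [k = i] c)` (products of stored
  ROWS only, as in `FarCertMachine`; registers saturated at the yardstick width `W = |x|`, `zcapF`);
* `traceF` — `capZ_W (∑ᵢ row_i(B) · row_i(T)) = capZ_W tr(B N)`; `flBody` — the loop body
  `⟨r, c, T⟩ ↦ ⟨r + 1, −tr(B N_l)/r, N_lᵀ⟩` (exact division `zquoPosF`); `zeroMatF` — the code of `0`;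
* **`adjNegF ⟨x, ⟨bin n, matCode B⟩⟩ = ⟨dpEnc (det (−B)), matCode (adj (−B))ᵀ⟩`** (`adjNegF_apply`) for
  `n ≤ |x|` and `(2n²b)ⁿ < 2^{|x|}` where `|B i j| ≤ b`, `1 ≤ b` (no register saturates, by the bounds
  `abs_flMat_le` … of the mathematics file), and `adjNegF ∈ FP` (`adjNegF_mem_FP`).

The caller chooses the yardstick; `B · (−adj(−B)) = det(−B) · 1` and `L((adj(−B))ᵀ) = L((adj B)ᵀ)`
make the signs harmless. Everything is proved; no named facts.

## References

* Z. Altaç, *Numerical Methods for Scientists and Engineers*, CRC 2024, §11.8, eqs. (11.104)–(11.106)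
  (the Faddeev–LeVerrier method with `A⁻¹` and `det A`). [Altac2024]
* O. Regev, *On lattices, learning with errors, random linear codes, and cryptography*, J. ACM 56
  (2009), art. 34 (arXiv:2401.03703), Lemma 3.20 (the `DGS` oracle is called on `L*`). [Regev2009]
* S. Arora, B. Barak, *Computational Complexity: A Modern Approach*, CUP 2009, §1.3 (polynomial time
  is closed under composition and bounded loops). [AroraBarak2009]
-/

noncomputable section

namespace Literature.Algebra.EuclideanLattices

open _root_.Computability Literature.Computability.Complexity Literature.Computability.Complexity.Brick Polynomial
open LLLMachine PRelSigPi FarCertMachine Literature.LinearAlgebra.Matrix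

namespace AdjMachine

/-! ### Small facts on codes -/

/-- Unary indices have equal binary value iff they are equal. [folklore] -/
theorem bitsToNat_ones_inj {k i : ℕ} : bitsToNat (ones k) = bitsToNat (ones i) ↔ k = i := by
  rw [bitsToNat_ones, bitsToNat_ones]
  constructor
  · intro h
    have hk := Nat.one_le_two_pow (n := k)
    have hi := Nat.one_le_two_pow (n := i)
    exact Nat.pow_right_injective le_rfl (Nat.sub_one_cancel hk hi h)
  · rintro rfl; rfl

/-- Rows of a matrix code read by `elemOf` (twin of `FarCertMachine.elemOf_matCode`, which lives in
`FarCertMachine.lean` above this file's import cone). [folklore] -/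
theorem elemOf_matCode {n m : ℕ} (b : Fin n → Fin m → ℤ) (i : Fin n) : elemOf (matCode b) i = rowCode (b i) := by
  rw [matCode, elemOf_encList, getD_ofFn_rowCode]

/-- `matCode` as a map over `range`. [folklore] -/
theorem matCode_eq_map_range {n m : ℕ} (b : Fin n → Fin m → ℤ) (f : ℕ → List Bool) (hf : ∀ i : Fin n, rowCode (b i) = f i) :
    matCode b = encList ((List.range n).map f) := by
  rw [matCode, show (List.ofFn fun i => rowCode (b i)) = List.ofFn (fun i : Fin n => f i) from
    congrArg List.ofFn (funext hf), ofFn_eq_map_range]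

/-! ### One entry of a recursion step: `capZ (row_k(T) · row_i(B) + [k = i] c)` -/

/-- The dot-product part on `⟨x, ⟨p, a⟩⟩`, `p = ⟨nn, ⟨M, ⟨rT, ⟨kk, c⟩⟩⟩⟩`, `a = 1ⁱ`:
`dotF ⟨x, ⟨nn, ⟨rT, M[i]⟩⟩⟩`. [folklore] -/
def entryDotF : List Bool → List Bool :=
  dotF ∘ fanoutFn (nthF 0) (fanoutFn (fstF ∘ nthF 1) (fanoutFn (nthF 2 ∘ nthF 1)
    (elemFn ∘ fanoutFn (sndPow 1) (nthF 1 ∘ nthF 1))))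

/-- `entryDotF ∈ FP`. [folklore] -/
theorem entryDotF_mem_FP : entryDotF ∈ FP :=
  comp_mem_FP dotF_mem_FP (fanoutFn_mem_FP (nthF_mem_FP 0) (fanoutFn_mem_FP (comp_mem_FP fstF_mem_FP (nthF_mem_FP 1))
    (fanoutFn_mem_FP (comp_mem_FP (nthF_mem_FP 2) (nthF_mem_FP 1))
      (comp_mem_FP elemFn_mem_FP (fanoutFn_mem_FP (sndPow_mem_FP 1) (comp_mem_FP (nthF_mem_FP 1) (nthF_mem_FP 1)))))))

/-- The diagonal test `[⟦kk⟧ = ⟦a⟧]` on `⟨x, ⟨p, a⟩⟩`. [folklore] -/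
def entryDiagF : List Bool → List Bool := eqValFn ∘ fanoutFn (nthF 3 ∘ nthF 1) (sndPow 1)

/-- `entryDiagF ∈ FP`. [folklore] -/
theorem entryDiagF_mem_FP : entryDiagF ∈ FP :=
  comp_mem_FP eqValFn_mem_FP (fanoutFn_mem_FP (comp_mem_FP (nthF_mem_FP 3) (nthF_mem_FP 1)) (sndPow_mem_FP 1))

/-- **The entry function** of a recursion step on `⟨x, ⟨⟨nn, ⟨M, ⟨rT, ⟨kk, c⟩⟩⟩⟩, a⟩⟩`:
`zcapF ⟨x, dot + [kk = a] c⟩`. [cite: Altac2024, §11.8 eq. (11.104)] -/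
def prodEntry : List Bool → List Bool :=
  zcapF ∘ fanoutFn (nthF 0) (iteFn entryDiagF (zaddF ∘ fanoutFn entryDotF (sndPow 3 ∘ nthF 1)) entryDotF)

/-- `prodEntry ∈ FP`. [folklore] -/
theorem prodEntry_mem_FP : prodEntry ∈ FP :=
  comp_mem_FP zcapF_mem_FP (fanoutFn_mem_FP (nthF_mem_FP 0) (iteFn_mem_FP entryDiagF_mem_FP
    (comp_mem_FP zaddF_mem_FP (fanoutFn_mem_FP entryDotF_mem_FP (comp_mem_FP (sndPow_mem_FP 3) (nthF_mem_FP 1)))) entryDotF_mem_FP))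

/-- `prodEntry` saturates: `≤ 2|x| + 2` on every input. [folklore] -/
theorem length_prodEntry_le (x p a : List Bool) :
    (prodEntry (boolPair x (boolPair p a))).length ≤ 0 * a.length + (2 * X + 2 : Polynomial ℕ).eval x.length := by
  have := length_zcapF_le (boolPair x ((iteFn entryDiagF (zaddF ∘ fanoutFn entryDotF (sndPow 3 ∘ nthF 1)) entryDotF)
    (boolPair x (boolPair p a))))
  simp only [prodEntry, Function.comp_apply, fanoutFn_apply, nthF_zero_boolPair, fstF_boolPair, eval_add, eval_mul,
    eval_ofNat, eval_X, zero_mul, zero_add] at this ⊢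
  exact this

/-- **Semantics of `prodEntry`** (`n ≤ |x|`, `i < n`). [folklore] -/
theorem prodEntry_apply (x : List Bool) {n : ℕ} (hn : n ≤ x.length) (B : Matrix (Fin n) (Fin n) ℤ)
    (v : Fin n → ℤ) (k : ℕ) (c : ℤ) (i : Fin n) :
    prodEntry (boolPair x (boolPair (boolPair (encodeNat n) (boolPair (matCode (fun i j => B i j))
      (boolPair (rowCode v) (boolPair (ones k) (dpEnc c))))) (ones i))) =
      dpEnc (capZ x.length (∑ t, v t * B i t + if k = i then c else 0)) := by
  have hdot : entryDotF (boolPair x (boolPair (boolPair (encodeNat n) (boolPair (matCode (fun i j => B i j))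
      (boolPair (rowCode v) (boolPair (ones k) (dpEnc c))))) (ones i))) = dpEnc (∑ t, v t * B i t) := by
    simp only [entryDotF, Function.comp_apply, fanoutFn_apply, nthF_zero_boolPair, nthF_succ_boolPair, fstF_boolPair,
      sndPow_succ_boolPair, sndPow_zero, sndF_boolPair, elemFn_boolPair, List.length_replicate]
    rw [elemOf_matCode (fun i j => B i j) i, dotF_apply x hn]
  have hdiag : entryDiagF (boolPair x (boolPair (boolPair (encodeNat n) (boolPair (matCode (fun i j => B i j))
      (boolPair (rowCode v) (boolPair (ones k) (dpEnc c))))) (ones i))) = [decide (k = (i : ℕ))] := by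
    simp only [entryDiagF, Function.comp_apply, fanoutFn_apply, nthF_succ_boolPair, nthF_zero_boolPair,
      sndPow_succ_boolPair, sndPow_zero, sndF_boolPair, eqValFn_boolPair, bitsToNat_ones_inj]
  rw [prodEntry, Function.comp_apply, fanoutFn_apply, nthF_zero_boolPair]
  by_cases hk : k = (i : ℕ)
  · rw [iteFn_apply_true (by rw [hdiag, hk]; simp), Function.comp_apply, fanoutFn_apply, hdot, zaddF_boolPair]
    simp only [Function.comp_apply, nthF_succ_boolPair, nthF_zero_boolPair, sndPow_succ_boolPair, sndPow_zero,
      sndF_boolPair, ival_dpEnc]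
    rw [zcapF_dpEnc, capZ, if_pos hk]
  · rw [iteFn_apply_false (by rw [hdiag]; simp [hk]), hdot, zcapF_dpEnc, capZ, if_neg hk, add_zero]

/-! ### One row, and the whole step `T ↦ N_lᵀ` -/

/-- **A row of the step** on `⟨x, ⟨nn, ⟨p, idx⟩⟩⟩`: the map of `prodEntry` over the index list. [folklore] -/
def prodRowF : List Bool → List Bool := mapLF prodEntry

/-- `prodRowF ∈ FP`. [folklore] -/
theorem prodRowF_mem_FP : prodRowF ∈ FP := mapLF_mem_FP prodEntry_mem_FP (w := 0) (by norm_num) length_prodEntry_le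

/-- Semantics of `prodRowF` (`n ≤ |x|`). [folklore] -/
theorem prodRowF_apply (x : List Bool) {n : ℕ} (hn : n ≤ x.length) (B : Matrix (Fin n) (Fin n) ℤ)
    (v : Fin n → ℤ) (k : ℕ) (c : ℤ) :
    prodRowF (boolPair x (boolPair (encodeNat n) (boolPair (boolPair (encodeNat n) (boolPair (matCode (fun i j => B i j))
      (boolPair (rowCode v) (boolPair (ones k) (dpEnc c))))) (idxList n)))) =
      rowCode (fun i : Fin n => capZ x.length (∑ t, v t * B i t + if k = i then c else 0)) := by
  rw [prodRowF, mapLF_idxList _ _ _ hn,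
    rowCode_eq_map_range (fun i : Fin n => capZ x.length (∑ t, v t * B i t + if k = i then c else 0))
      (fun i => if h : i < n then capZ x.length (∑ t, v t * B ⟨i, h⟩ t + if k = i then c else 0) else 0)
      (fun i => by rw [dif_pos i.isLt])]
  refine congrArg encList (List.map_congr_left fun i hi => ?_)
  have hi' : i < n := List.mem_range.1 hi
  rw [dif_pos hi', prodEntry_apply x hn B v k c ⟨i, hi'⟩]

/-- Length of `prodRowF`: absolute, `≤ |x|(4|x| + 8)`. [folklore] -/
theorem length_prodRowF_le (z : List Bool) : (prodRowF z).length ≤ (fstF z).length * (4 * (fstF z).length + 8) := by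
  have h := length_mapLF_le (f := prodEntry) 0 (P := 2 * X + 2) length_prodEntry_le z
  simp only [zero_mul, zero_add, eval_add, eval_mul, eval_ofNat, eval_X] at h
  rw [prodRowF]
  nlinarith

/-- The row item on `⟨x, ⟨q, a⟩⟩`, `q = ⟨nn, ⟨M, ⟨idx, ⟨c, T⟩⟩⟩⟩`, `a = 1ᵏ`: the row of index `k`, i.e.
`prodRowF ⟨x, ⟨nn, ⟨⟨nn, ⟨M, ⟨T[k], ⟨a, c⟩⟩⟩⟩, idx⟩⟩⟩`. [folklore] -/
def prodRowItem : List Bool → List Bool :=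
  prodRowF ∘ fanoutFn (nthF 0) (fanoutFn (fstF ∘ nthF 1) (fanoutFn
    (fanoutFn (fstF ∘ nthF 1) (fanoutFn (nthF 1 ∘ nthF 1) (fanoutFn (elemFn ∘ fanoutFn (sndPow 1) (sndPow 3 ∘ nthF 1))
      (fanoutFn (sndPow 1) (nthF 3 ∘ nthF 1)))))
    (nthF 2 ∘ nthF 1)))

/-- `prodRowItem ∈ FP`. [folklore] -/
theorem prodRowItem_mem_FP : prodRowItem ∈ FP :=
  comp_mem_FP prodRowF_mem_FP (fanoutFn_mem_FP (nthF_mem_FP 0) (fanoutFn_mem_FP (comp_mem_FP fstF_mem_FP (nthF_mem_FP 1))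
    (fanoutFn_mem_FP
      (fanoutFn_mem_FP (comp_mem_FP fstF_mem_FP (nthF_mem_FP 1)) (fanoutFn_mem_FP (comp_mem_FP (nthF_mem_FP 1) (nthF_mem_FP 1))
        (fanoutFn_mem_FP (comp_mem_FP elemFn_mem_FP (fanoutFn_mem_FP (sndPow_mem_FP 1) (comp_mem_FP (sndPow_mem_FP 3) (nthF_mem_FP 1))))
          (fanoutFn_mem_FP (sndPow_mem_FP 1) (comp_mem_FP (nthF_mem_FP 3) (nthF_mem_FP 1))))))
      (comp_mem_FP (nthF_mem_FP 2) (nthF_mem_FP 1)))))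

/-- Semantics of `prodRowItem` (`n ≤ |x|`, `k < n`). [folklore] -/
theorem prodRowItem_apply (x : List Bool) {n : ℕ} (hn : n ≤ x.length) (B : Matrix (Fin n) (Fin n) ℤ)
    (T : Fin n → Fin n → ℤ) (c : ℤ) (k : Fin n) :
    prodRowItem (boolPair x (boolPair (boolPair (encodeNat n) (boolPair (matCode (fun i j => B i j))
      (boolPair (idxList n) (boolPair (dpEnc c) (matCode T))))) (ones k))) =
      rowCode (fun i : Fin n => capZ x.length (∑ t, T k t * B i t + if (k : ℕ) = i then c else 0)) := by
  simp only [prodRowItem, Function.comp_apply, fanoutFn_apply, nthF_zero_boolPair, nthF_succ_boolPair, fstF_boolPair,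
    sndPow_succ_boolPair, sndPow_zero, sndF_boolPair, elemFn_boolPair, List.length_replicate]
  rw [elemOf_matCode T k]
  exact prodRowF_apply x hn B (T k) k c

/-- `prodRowItem` has absolutely bounded output. [folklore] -/
theorem length_prodRowItem_le (x p a : List Bool) :
    (prodRowItem (boolPair x (boolPair p a))).length ≤ 0 * a.length + (X * (4 * X + 8) : Polynomial ℕ).eval x.length := by
  rw [prodRowItem, Function.comp_apply]
  have := length_prodRowF_le (fanoutFn (nthF 0) (fanoutFn (fstF ∘ nthF 1) (fanoutFn
    (fanoutFn (fstF ∘ nthF 1) (fanoutFn (nthF 1 ∘ nthF 1) (fanoutFn (elemFn ∘ fanoutFn (sndPow 1) (sndPow 3 ∘ nthF 1))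
      (fanoutFn (sndPow 1) (nthF 3 ∘ nthF 1))))) (nthF 2 ∘ nthF 1))) (boolPair x (boolPair p a)))
  simp only [fanoutFn_apply, nthF_zero_boolPair, fstF_boolPair, eval_add, eval_mul, eval_ofNat, eval_X, zero_mul,
    zero_add] at this ⊢
  exact this

/-- **One recursion step on codes** on `w = ⟨x, ⟨nn, ⟨M, ⟨idx, ⟨c, T⟩⟩⟩⟩⟩`: the map of `prodRowItem` over the
index list with parameter `sndF w`. [cite: Altac2024, §11.8 eq. (11.104)] -/
def stepTF : List Bool → List Bool := mapLF prodRowItem ∘ fanoutFn fstF (fanoutFn (nthF 1) (fanoutFn sndF (nthF 3)))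

/-- `stepTF ∈ FP`. [folklore] -/
theorem stepTF_mem_FP : stepTF ∈ FP :=
  comp_mem_FP (mapLF_mem_FP prodRowItem_mem_FP (w := 0) (by norm_num) length_prodRowItem_le)
    (fanoutFn_mem_FP fstF_mem_FP (fanoutFn_mem_FP (nthF_mem_FP 1) (fanoutFn_mem_FP sndF_mem_FP (nthF_mem_FP 3))))

/-- **Semantics of `stepTF`**: from the code of `T` (rows) and `c`, the code of the matrix with rows
`k ↦ (i ↦ capZ_W (∑ₜ T k t · B i t + [k = i] c))`. [cite: Altac2024, §11.8 eq. (11.104)] -/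
theorem stepTF_apply (x : List Bool) {n : ℕ} (hn : n ≤ x.length) (B : Matrix (Fin n) (Fin n) ℤ)
    (T : Fin n → Fin n → ℤ) (c : ℤ) :
    stepTF (boolPair x (boolPair (encodeNat n) (boolPair (matCode (fun i j => B i j))
      (boolPair (idxList n) (boolPair (dpEnc c) (matCode T)))))) =
      matCode (fun k i : Fin n => capZ x.length (∑ t, T k t * B i t + if k = i then c else 0)) := by
  simp only [stepTF, Function.comp_apply, fanoutFn_apply, fstF_boolPair, nthF_succ_boolPair, nthF_zero_boolPair,
    sndF_boolPair]
  rw [mapLF_idxList _ _ _ hn, matCode_eq_map_range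
      (fun k i : Fin n => capZ x.length (∑ t, T k t * B i t + if k = i then c else 0))
      (fun k => if h : k < n then rowCode (fun i : Fin n =>
        capZ x.length (∑ t, T ⟨k, h⟩ t * B i t + if k = (i : ℕ) then c else 0)) else [])
      (fun k => by rw [dif_pos k.isLt]; exact congrArg rowCode (funext fun i => by simp [Fin.ext_iff]))]
  refine congrArg encList (List.map_congr_left fun k hk => ?_)
  have hk' : k < n := List.mem_range.1 hk
  rw [dif_pos hk', prodRowItem_apply x hn B T c ⟨k, hk'⟩]

/-- Length of `stepTF`: absolute, `≤ |x|(2|x|(4|x| + 8) + 4)`. [folklore] -/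
theorem length_stepTF_le (z : List Bool) :
    (stepTF z).length ≤ (fstF z).length * (2 * ((fstF z).length * (4 * (fstF z).length + 8)) + 4) := by
  rw [stepTF, Function.comp_apply]
  set w := fanoutFn fstF (fanoutFn (nthF 1) (fanoutFn sndF (nthF 3))) z
  have h := length_mapLF_le (f := prodRowItem) 0 (P := X * (4 * X + 8)) length_prodRowItem_le w
  have e0 : fstF w = fstF z := by simp [w]
  rw [e0] at h
  simp only [zero_mul, zero_add, eval_add, eval_mul, eval_ofNat, eval_X] at h
  exact h

/-! ### The trace `tr(B N) = ∑ᵢ row_i(B) · row_i(Nᵀ)` -/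

/-- The accumulation step of the trace on `⟨x, ⟨p, ⟨a, ⟨b, acc⟩⟩⟩⟩`: `acc + dotF ⟨x, ⟨p, ⟨a, b⟩⟩⟩`
(sign-free accumulation). [folklore] -/
def trStep : List Bool → List Bool :=
  iaddFn ∘ fanoutFn (sndPow 3) (dotF ∘ fanoutFn (nthF 0) (fanoutFn (nthF 1) (fanoutFn (nthF 2) (nthF 3))))

/-- `trStep ∈ FP`. [folklore] -/
theorem trStep_mem_FP : trStep ∈ FP :=
  comp_mem_FP iaddFn_mem_FP (fanoutFn_mem_FP (sndPow_mem_FP 3) (comp_mem_FP dotF_mem_FP (fanoutFn_mem_FP (nthF_mem_FP 0)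
    (fanoutFn_mem_FP (nthF_mem_FP 1) (fanoutFn_mem_FP (nthF_mem_FP 2) (nthF_mem_FP 3))))))

/-- Value of the trace step. [folklore] -/
theorem ival_trStep (x : List Bool) {n : ℕ} (hn : n ≤ x.length) (v w : Fin n → ℤ) (acc : List Bool) :
    ival (trStep (boolPair x (boolPair (encodeNat n) (boolPair (rowCode v) (boolPair (rowCode w) acc))))) =
      ival acc + ∑ t, v t * w t := by
  simp only [trStep, Function.comp_apply, fanoutFn_apply, sndPow_succ_boolPair, sndPow_zero, sndF_boolPair,
    nthF_zero_boolPair, nthF_succ_boolPair]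
  rw [dotF_apply x hn, ival_iaddFn_boolPair, ival_dpEnc]

/-- Growth of the trace step: `≤ |acc| + 2(|a| + |b|) + (14|x| + 11)`. [folklore] -/
theorem length_trStep_le (x p a b acc : List Bool) :
    (trStep (boolPair x (boolPair p (boolPair a (boolPair b acc))))).length ≤
      acc.length + 2 * (a.length + b.length) + (14 * X + 11 : Polynomial ℕ).eval x.length := by
  have h1 := length_iaddFn_boolPair_le acc (dotF (boolPair x (boolPair p (boolPair a b))))
  have h2 := length_dotF_le (boolPair x (boolPair p (boolPair a b)))
  simp only [trStep, Function.comp_apply, fanoutFn_apply, sndPow_succ_boolPair, sndPow_zero, sndF_boolPair,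
    nthF_zero_boolPair, nthF_succ_boolPair, fstF_boolPair, eval_add, eval_mul, eval_ofNat, eval_X] at h1 h2 ⊢
  omega

/-- **The trace** on `⟨x, ⟨nn, ⟨M, T⟩⟩⟩`: `zcapF ⟨x, canonical (∑ᵢ M[i] · T[i])⟩`. [cite: Altac2024, §11.8 eq. (11.104)] -/
def traceF : List Bool → List Bool :=
  zcapF ∘ fanoutFn (nthF 0) (zcanonF ∘ zipFoldLF trStep ∘
    fanoutFn (nthF 0) (fanoutFn (nthF 1) (fanoutFn (nthF 1) (fanoutFn (nthF 2) (fanoutFn (sndPow 2) (fun _ => dpEnc 0))))))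

/-- `traceF ∈ FP`. [folklore] -/
theorem traceF_mem_FP : traceF ∈ FP :=
  comp_mem_FP zcapF_mem_FP (fanoutFn_mem_FP (nthF_mem_FP 0) (comp_mem_FP zcanonF_mem_FP (comp_mem_FP
    (zipFoldLF_mem_FP trStep_mem_FP (P := 14 * X + 11) length_trStep_le)
    (fanoutFn_mem_FP (nthF_mem_FP 0) (fanoutFn_mem_FP (nthF_mem_FP 1) (fanoutFn_mem_FP (nthF_mem_FP 1)
      (fanoutFn_mem_FP (nthF_mem_FP 2) (fanoutFn_mem_FP (sndPow_mem_FP 2) (const_mem_FP _)))))))))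

/-- The value of the folded trace accumulation. [folklore] -/
theorem ival_zipFoldValue_trStep (x : List Bool) {n : ℕ} (hn : n ≤ x.length) :
    ∀ (V W : List (Fin n → ℤ)) (init : List Bool),
      ival (zipFoldValue trStep x (encodeNat n) (V.map rowCode) (W.map rowCode) init) =
        ival init + ((V.zip W).map fun vw => ∑ t, vw.1 t * vw.2 t).sum
  | [], W, init => by simp [zipFoldValue]
  | v :: V, [], init => by simp [zipFoldValue]
  | v :: V, w :: W, init => by
    have := ival_zipFoldValue_trStep x hn V W (trStep (boolPair x (boolPair (encodeNat n)
      (boolPair (rowCode v) (boolPair (rowCode w) init)))))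
    simp only [zipFoldValue, List.map_cons, List.zip_cons_cons, List.foldl_cons, List.sum_cons] at this ⊢
    rw [this, ival_trStep x hn]; ring

/-- **Semantics of `traceF`** (`n ≤ |x|`): `dpEnc (capZ_W (∑ᵢ ∑ₜ B i t · T i t))`. [folklore] -/
theorem traceF_apply (x : List Bool) {n : ℕ} (hn : n ≤ x.length) (B : Matrix (Fin n) (Fin n) ℤ) (T : Fin n → Fin n → ℤ) :
    traceF (boolPair x (boolPair (encodeNat n) (boolPair (matCode (fun i j => B i j)) (matCode T)))) =
      dpEnc (capZ x.length (∑ i, ∑ t, B i t * T i t)) := by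
  simp only [traceF, Function.comp_apply, fanoutFn_apply, nthF_zero_boolPair, nthF_succ_boolPair, sndPow_succ_boolPair,
    sndPow_zero, sndF_boolPair, matCode]
  have e1 : (List.ofFn fun i => rowCode fun j => B i j) = (List.ofFn fun i : Fin n => fun j => B i j).map rowCode := by
    rw [List.map_ofFn]; rfl
  have e2 : (List.ofFn fun i => rowCode (T i)) = (List.ofFn T).map rowCode := by
    rw [List.map_ofFn]; rfl
  rw [zipFoldLF_apply _ _ _ hn, List.take_of_length_le (by simp), List.take_of_length_le (by simp), zcanonF_eq, e1, e2,
    ival_zipFoldValue_trStep x hn, ival_dpEnc, zero_add, zip_ofFn, List.map_ofFn, List.sum_ofFn, zcapF_dpEnc, capZ]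
  rfl

/-- `traceF` saturates: `≤ 2|x| + 2` on every input. [folklore] -/
theorem length_traceF_le (z : List Bool) : (traceF z).length ≤ 2 * (fstF z).length + 2 := by
  rw [traceF, Function.comp_apply, fanoutFn_apply]
  have := length_zcapF_le (boolPair (nthF 0 z) ((zcanonF ∘ zipFoldLF trStep ∘
    fanoutFn (nthF 0) (fanoutFn (nthF 1) (fanoutFn (nthF 1) (fanoutFn (nthF 2) (fanoutFn (sndPow 2) (fun _ => dpEnc 0)))))) z))
  simpa using this

/-! ### The zero matrix -/

/-- A row of zeros on `⟨x, ⟨nn, ⟨p, idx⟩⟩⟩`. [folklore] -/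
def zeroRowF : List Bool → List Bool := mapLF (fun _ => dpEnc 0)

/-- The constant item has absolutely bounded output. [folklore] -/
theorem length_zeroItem_le (x p a : List Bool) :
    ((fun _ : List Bool => dpEnc 0) (boolPair x (boolPair p a))).length ≤ 0 * a.length + (2 : Polynomial ℕ).eval x.length := by
  simp [dpEnc_zero, length_boolPair]

/-- `zeroRowF ∈ FP`. [folklore] -/
theorem zeroRowF_mem_FP : zeroRowF ∈ FP :=
  mapLF_mem_FP (const_mem_FP _) (w := 0) (by norm_num) (P := 2) length_zeroItem_le

/-- Semantics of `zeroRowF`. [folklore] -/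
theorem zeroRowF_apply (x : List Bool) {n : ℕ} (hn : n ≤ x.length) (p : List Bool) :
    zeroRowF (boolPair x (boolPair (encodeNat n) (boolPair p (idxList n)))) = rowCode (0 : Fin n → ℤ) := by
  rw [zeroRowF, mapLF_idxList _ _ _ hn, rowCode_eq_map_range (0 : Fin n → ℤ) (fun _ => 0) (fun _ => rfl)]

/-- Length of `zeroRowF`: `≤ 8|x|`. [folklore] -/
theorem length_zeroRowF_le (z : List Bool) : (zeroRowF z).length ≤ (fstF z).length * 8 := by
  have h := length_mapLF_le (f := fun _ => dpEnc 0) 0 (P := 2) length_zeroItem_le z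
  simp only [zero_mul, zero_add, eval_ofNat] at h
  rw [zeroRowF]
  exact h

/-- The zero-row item on `⟨x, ⟨⟨nn, idx⟩, a⟩⟩`. [folklore] -/
def zeroRowItem : List Bool → List Bool :=
  zeroRowF ∘ fanoutFn (nthF 0) (fanoutFn (fstF ∘ nthF 1) (fanoutFn (sndPow 1) (sndF ∘ nthF 1)))

/-- `zeroRowItem ∈ FP`. [folklore] -/
theorem zeroRowItem_mem_FP : zeroRowItem ∈ FP :=
  comp_mem_FP zeroRowF_mem_FP (fanoutFn_mem_FP (nthF_mem_FP 0) (fanoutFn_mem_FP (comp_mem_FP fstF_mem_FP (nthF_mem_FP 1))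
    (fanoutFn_mem_FP (sndPow_mem_FP 1) (comp_mem_FP sndF_mem_FP (nthF_mem_FP 1)))))

/-- Semantics of `zeroRowItem`. [folklore] -/
theorem zeroRowItem_apply (x : List Bool) {n : ℕ} (hn : n ≤ x.length) (a : List Bool) :
    zeroRowItem (boolPair x (boolPair (boolPair (encodeNat n) (idxList n)) a)) = rowCode (0 : Fin n → ℤ) := by
  simp only [zeroRowItem, Function.comp_apply, fanoutFn_apply, nthF_zero_boolPair, nthF_succ_boolPair, fstF_boolPair,
    sndPow_succ_boolPair, sndPow_zero, sndF_boolPair]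
  exact zeroRowF_apply x hn a

/-- `zeroRowItem` has absolutely bounded output. [folklore] -/
theorem length_zeroRowItem_le (x p a : List Bool) :
    (zeroRowItem (boolPair x (boolPair p a))).length ≤ 0 * a.length + (X * 8 : Polynomial ℕ).eval x.length := by
  have := length_zeroRowF_le (boolPair x (boolPair (fstF p) (boolPair a (sndF p))))
  simp only [zeroRowItem, Function.comp_apply, fanoutFn_apply, nthF_zero_boolPair, nthF_succ_boolPair, fstF_boolPair,
    sndPow_succ_boolPair, sndPow_zero, sndF_boolPair, eval_mul, eval_ofNat, eval_X, zero_mul, zero_add] at this ⊢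
  exact this

/-- **The zero matrix** on `⟨x, ⟨nn, idx⟩⟩`: `matCode 0`. [folklore] -/
def zeroMatF : List Bool → List Bool :=
  mapLF zeroRowItem ∘ fanoutFn fstF (fanoutFn (nthF 1) (fanoutFn sndF (sndPow 1)))

/-- `zeroMatF ∈ FP`. [folklore] -/
theorem zeroMatF_mem_FP : zeroMatF ∈ FP :=
  comp_mem_FP (mapLF_mem_FP zeroRowItem_mem_FP (w := 0) (by norm_num) length_zeroRowItem_le)
    (fanoutFn_mem_FP fstF_mem_FP (fanoutFn_mem_FP (nthF_mem_FP 1) (fanoutFn_mem_FP sndF_mem_FP (sndPow_mem_FP 1))))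

/-- Semantics of `zeroMatF` (`n ≤ |x|`). [folklore] -/
theorem zeroMatF_apply (x : List Bool) {n : ℕ} (hn : n ≤ x.length) :
    zeroMatF (boolPair x (boolPair (encodeNat n) (idxList n))) = matCode (fun _ _ : Fin n => (0 : ℤ)) := by
  simp only [zeroMatF, Function.comp_apply, fanoutFn_apply, fstF_boolPair, nthF_succ_boolPair, nthF_zero_boolPair,
    sndF_boolPair, sndPow_succ_boolPair, sndPow_zero]
  rw [mapLF_idxList _ _ _ hn, matCode_eq_map_range (fun _ _ : Fin n => (0 : ℤ)) (fun _ => rowCode (0 : Fin n → ℤ)) (fun _ => rfl)]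
  exact congrArg encList (List.map_congr_left fun k _ => zeroRowItem_apply x hn _)

/-! ### The loop body: `⟨r, c, T⟩ ↦ ⟨r + 1, −tr(B N_l)/r, N_lᵀ⟩` -/

/-- The record `w = ⟨x, ⟨nn, ⟨M, ⟨idx, ⟨c, T⟩⟩⟩⟩⟩` assembled from the loop record
`z = ⟨x, ⟨cnt, ⟨⟨nn, ⟨M, idx⟩⟩, ⟨rr, ⟨c, T⟩⟩⟩⟩⟩`. [folklore] -/
def bodyW : List Bool → List Bool :=
  fanoutFn (nthF 0) (fanoutFn (fstF ∘ nthF 2) (fanoutFn (nthF 1 ∘ nthF 2) (fanoutFn (sndPow 1 ∘ nthF 2) (sndPow 3))))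

/-- `bodyW ∈ FP`. [folklore] -/
theorem bodyW_mem_FP : bodyW ∈ FP :=
  fanoutFn_mem_FP (nthF_mem_FP 0) (fanoutFn_mem_FP (comp_mem_FP fstF_mem_FP (nthF_mem_FP 2))
    (fanoutFn_mem_FP (comp_mem_FP (nthF_mem_FP 1) (nthF_mem_FP 2)) (fanoutFn_mem_FP (comp_mem_FP (sndPow_mem_FP 1) (nthF_mem_FP 2)) (sndPow_mem_FP 3))))

/-- The new coefficient on the staged record `⟨z, T'⟩`: `capZ_W ((−tr(B N_l)) / r)` with the trace read
off `⟨x, ⟨nn, ⟨M, T'⟩⟩⟩`, the divisor `rr`, and a final saturation (inactive on the intended data) so that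
the register is absolutely bounded. [cite: Altac2024, §11.8 eq. (11.104)] -/
def newCoefF : List Bool → List Bool :=
  zcapF ∘ fanoutFn (nthF 0 ∘ fstF) (zquoPosF ∘ fanoutFn
    (znegF ∘ traceF ∘ fanoutFn (nthF 0 ∘ fstF) (fanoutFn (fstF ∘ nthF 2 ∘ fstF) (fanoutFn (nthF 1 ∘ nthF 2 ∘ fstF) sndF)))
    (nthF 3 ∘ fstF))

/-- `newCoefF ∈ FP`. [folklore] -/
theorem newCoefF_mem_FP : newCoefF ∈ FP :=
  comp_mem_FP zcapF_mem_FP (fanoutFn_mem_FP (comp_mem_FP (nthF_mem_FP 0) fstF_mem_FP) (comp_mem_FP zquoPosF_mem_FP (fanoutFn_mem_FP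
    (comp_mem_FP znegF_mem_FP (comp_mem_FP traceF_mem_FP (fanoutFn_mem_FP (comp_mem_FP (nthF_mem_FP 0) fstF_mem_FP)
      (fanoutFn_mem_FP (comp_mem_FP fstF_mem_FP (comp_mem_FP (nthF_mem_FP 2) fstF_mem_FP))
        (fanoutFn_mem_FP (comp_mem_FP (nthF_mem_FP 1) (comp_mem_FP (nthF_mem_FP 2) fstF_mem_FP)) sndF_mem_FP)))))
    (comp_mem_FP (nthF_mem_FP 3) fstF_mem_FP))))

/-- `newCoefF` saturates: `≤ 2|x| + 2` (with `x = nthF 0 (fstF v)`). [folklore] -/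
theorem length_newCoefF_le (v : List Bool) : (newCoefF v).length ≤ 2 * (nthF 0 (fstF v)).length + 2 := by
  rw [newCoefF, Function.comp_apply, fanoutFn_apply]
  have := length_zcapF_le (boolPair ((nthF 0 ∘ fstF) v) ((zquoPosF ∘ fanoutFn
    (znegF ∘ traceF ∘ fanoutFn (nthF 0 ∘ fstF) (fanoutFn (fstF ∘ nthF 2 ∘ fstF) (fanoutFn (nthF 1 ∘ nthF 2 ∘ fstF) sndF)))
    (nthF 3 ∘ fstF)) v))
  simpa using this

/-- **The loop body** on `z = ⟨x, ⟨cnt, ⟨q, ⟨rr, ⟨c, T⟩⟩⟩⟩⟩` (`q = ⟨nn, ⟨M, idx⟩⟩` fixed): the new state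
`⟨q, ⟨rr + 1, ⟨c', T'⟩⟩⟩` with `T' = stepTF w`, `c' = newCoefF ⟨z, T'⟩`. [cite: Altac2024, §11.8 eq. (11.104)] -/
def flBody : List Bool → List Bool :=
  fanoutFn (nthF 2 ∘ fstF) (fanoutFn (addFn ∘ fanoutFn (nthF 3 ∘ fstF) (fun _ => [true])) (fanoutFn newCoefF sndF)) ∘
    fanoutFn (fun z => z) (stepTF ∘ bodyW)

/-- `flBody ∈ FP`. [folklore] -/
theorem flBody_mem_FP : flBody ∈ FP :=
  comp_mem_FP (fanoutFn_mem_FP (comp_mem_FP (nthF_mem_FP 2) fstF_mem_FP) (fanoutFn_mem_FP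
      (comp_mem_FP addFn_mem_FP (fanoutFn_mem_FP (comp_mem_FP (nthF_mem_FP 3) fstF_mem_FP) (const_mem_FP _)))
      (fanoutFn_mem_FP newCoefF_mem_FP sndF_mem_FP)))
    (fanoutFn_mem_FP (PolyTimeComputable.id _) (comp_mem_FP stepTF_mem_FP bodyW_mem_FP))

/-- The mathematical step on rows: `T' k i = capZ_W (∑ₜ T k t · B i t + [k = i] c)`. [folklore] -/
def stepRows {n : ℕ} (W : ℕ) (B : Matrix (Fin n) (Fin n) ℤ) (c : ℤ) (T : Fin n → Fin n → ℤ) : Fin n → Fin n → ℤ :=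
  fun k i => capZ W (∑ t, T k t * B i t + if k = i then c else 0)

/-- The mathematical new coefficient: `capZ_W ((− capZ_W (∑ᵢ ∑ₜ B i t · T' i t)) / r)`. [folklore] -/
def newCoef {n : ℕ} (W : ℕ) (B : Matrix (Fin n) (Fin n) ℤ) (r : ℕ) (T' : Fin n → Fin n → ℤ) : ℤ :=
  capZ W ((-capZ W (∑ i, ∑ t, B i t * T' i t)) / (r : ℤ))

/-- **Semantics of the loop body** on a well-formed loop record (`n ≤ |x|`, `0 < r`). [folklore] -/
theorem flBody_apply (x : List Bool) {n : ℕ} (hn : n ≤ x.length) (B : Matrix (Fin n) (Fin n) ℤ) (cnt : List Bool)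
    {r : ℕ} (hr : 0 < r) (c : ℤ) (T : Fin n → Fin n → ℤ) :
    flBody (boolPair x (boolPair cnt (boolPair (boolPair (encodeNat n) (boolPair (matCode (fun i j => B i j)) (idxList n)))
      (boolPair (encodeNat r) (boolPair (dpEnc c) (matCode T)))))) =
      boolPair (boolPair (encodeNat n) (boolPair (matCode (fun i j => B i j)) (idxList n)))
        (boolPair (encodeNat (r + 1)) (boolPair (dpEnc (newCoef x.length B r (stepRows x.length B c T)))
          (matCode (stepRows x.length B c T)))) := by
  have hT : stepTF (bodyW (boolPair x (boolPair cnt (boolPair (boolPair (encodeNat n) (boolPair (matCode (fun i j => B i j))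
      (idxList n))) (boolPair (encodeNat r) (boolPair (dpEnc c) (matCode T))))))) = matCode (stepRows x.length B c T) := by
    simp only [bodyW, fanoutFn_apply, nthF_zero_boolPair, nthF_succ_boolPair, Function.comp_apply, fstF_boolPair,
      sndPow_succ_boolPair, sndPow_zero, sndF_boolPair]
    exact stepTF_apply x hn B T c
  have h1 : bitsToNat [true] = 1 := by simp [bitsToNat]
  have hC : newCoefF (boolPair (boolPair x (boolPair cnt (boolPair (boolPair (encodeNat n) (boolPair (matCode (fun i j => B i j))
      (idxList n))) (boolPair (encodeNat r) (boolPair (dpEnc c) (matCode T)))))) (matCode (stepRows x.length B c T))) =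
      dpEnc (newCoef x.length B r (stepRows x.length B c T)) := by
    simp only [newCoefF, Function.comp_apply, fanoutFn_apply, fstF_boolPair, nthF_zero_boolPair, nthF_succ_boolPair,
      sndF_boolPair]
    rw [traceF_apply x hn B, znegF_eq, ival_dpEnc, zquoPosF_dpEnc _ _ (by rw [bitsToNat_encodeNat]; exact hr),
      bitsToNat_encodeNat, zcapF_dpEnc, newCoef]
    rfl
  simp only [flBody, Function.comp_apply, fanoutFn_apply, fstF_boolPair, sndF_boolPair, nthF_succ_boolPair,
    nthF_zero_boolPair, hT, addFn_boolPair, bitsToNat_encodeNat, h1, hC]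

/-- **Growth of the loop body**: `|flBody z| ≤ |state| + P(|x|)` on EVERY record, with
`P = X(2X(4X+8)+4) + 4X + 16`. [folklore] -/
theorem length_flBody_le (z : List Bool) :
    (flBody z).length ≤ (sndPow 1 z).length + (X * (2 * (X * (4 * X + 8)) + 4) + 4 * X + 16 : Polynomial ℕ).eval (fstF z).length := by
  simp only [flBody, fanoutFn_apply, Function.comp_apply, fstF_boolPair, sndF_boolPair, length_boolPair]
  -- the pieces
  have hq : 2 * (nthF 2 z).length + (sndPow 2 z).length ≤ (sndPow 1 z).length := by
    have := length_nthF_succ_add_sndPow_succ_le 1 z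
    simpa using this
  have hr : 2 * (nthF 3 z).length + (sndPow 3 z).length ≤ (sndPow 2 z).length := by
    have := length_nthF_succ_add_sndPow_succ_le 2 z
    simpa using this
  have hadd : (addFn (boolPair (nthF 3 z) [true])).length ≤ (nthF 3 z).length + 2 := by
    have := length_addFn_le (boolPair (nthF 3 z) [true])
    simpa using this
  have hc : (newCoefF (boolPair z (stepTF (bodyW z)))).length ≤ 2 * (fstF z).length + 2 := by
    have := length_newCoefF_le (boolPair z (stepTF (bodyW z)))
    simpa using this
  have hT : (stepTF (bodyW z)).length ≤ (fstF z).length * (2 * ((fstF z).length * (4 * (fstF z).length + 8)) + 4) := by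
    have := length_stepTF_le (bodyW z)
    have e : fstF (bodyW z) = fstF z := by simp [bodyW]
    rw [e] at this
    exact this
  simp only [eval_add, eval_mul, eval_X, eval_ofNat]
  generalize (fstF z).length * (2 * ((fstF z).length * (4 * (fstF z).length + 8)) + 4) = P at hT ⊢
  omega

/-! ### The loop and its invariant -/

/-- The leading coefficient of the characteristic polynomial is `1`. [folklore] -/
theorem charpoly_coeff_card {m : Type*} [Fintype m] [DecidableEq m] (M : Matrix m m ℤ) :
    M.charpoly.coeff (Fintype.card m) = 1 := by
  have h := M.charpoly_monic
  rw [Polynomial.Monic, Polynomial.leadingCoeff, Matrix.charpoly_natDegree_eq_dim] at h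
  exact h

/-- The loop state after `j` rounds: `⟨q, ⟨bin (j+1), ⟨dpEnc c_{n-j}, matCode N_{n-j}ᵀ⟩⟩⟩`. [folklore] -/
def loopState {n : ℕ} (B : Matrix (Fin n) (Fin n) ℤ) (j : ℕ) : List Bool :=
  boolPair (boolPair (encodeNat n) (boolPair (matCode (fun i j => B i j)) (idxList n)))
    (boolPair (encodeNat (j + 1)) (boolPair (dpEnc (B.charpoly.coeff (n - j)))
      (matCode (fun k i : Fin n => flMat B (n - j) i k))))

/-- The register width suffices: all Faddeev–LeVerrier quantities are below `2^W`. [folklore] -/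
structure WidthOK {n : ℕ} (W : ℕ) (B : Matrix (Fin n) (Fin n) ℤ) : Prop where
  flMat_lt : ∀ l (i k : Fin n), (flMat B l i k).natAbs < 2 ^ W
  trace_lt : ∀ l, ((B * flMat B l).trace).natAbs < 2 ^ W
  coeff_lt : ∀ l, l < n → (B.charpoly.coeff l).natAbs < 2 ^ W

/-- **The width condition from an entry bound**: if `|B i j| ≤ b`, `1 ≤ b` and
`n² b (2n²b)^{n-1} < 2^W`, then no register saturates. [folklore] -/
theorem widthOK_of_bound {n : ℕ} {W b : ℕ} (B : Matrix (Fin n) (Fin n) ℤ) (hb : ∀ i j, |B i j| ≤ b) (hb1 : 1 ≤ b)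
    (hW : n ^ 2 * b * (2 * n ^ 2 * b) ^ (n - 1) < 2 ^ W) : WidthOK W B := by
  rcases Nat.eq_zero_or_pos n with hn0 | hn0
  · subst hn0
    exact ⟨fun l i k => i.elim0, fun l => by simp [Matrix.trace], fun l hl => absurd hl (Nat.not_lt_zero _)⟩
  have hW' : ((n ^ 2 * b * (2 * n ^ 2 * b) ^ (n - 1) : ℕ) : ℤ) < 2 ^ W := by exact_mod_cast hW
  have h1 : (1 : ℤ) ≤ 2 * (n : ℤ) ^ 2 * b := by
    have : (1 : ℤ) ≤ n := by exact_mod_cast hn0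
    have : (1 : ℤ) ≤ b := by exact_mod_cast hb1
    nlinarith
  have h2 : (1 : ℤ) ≤ (n : ℤ) ^ 2 * b := by
    have : (1 : ℤ) ≤ n := by exact_mod_cast hn0
    have : (1 : ℤ) ≤ b := by exact_mod_cast hb1
    nlinarith
  -- `N² b K^{N-1-l} ≤ n² b K^{n-1}` and `K^{N-1-l} ≤ n² b K^{n-1}`
  have hNb : ∀ l, (Fintype.card (Fin n) : ℤ) ^ 2 * b * ((2 * Fintype.card (Fin n) ^ 2 * b : ℕ) : ℤ) ^ (Fintype.card (Fin n) - 1 - l) ≤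
      ((n ^ 2 * b * (2 * n ^ 2 * b) ^ (n - 1) : ℕ) : ℤ) := by
    intro l
    rw [Fintype.card_fin]
    push_cast
    exact mul_le_mul_of_nonneg_left (pow_le_pow_right₀ h1 (Nat.sub_le _ _)) (by positivity)
  have hK : ∀ l, ((2 * Fintype.card (Fin n) ^ 2 * b : ℕ) : ℤ) ^ (Fintype.card (Fin n) - 1 - l) ≤
      ((n ^ 2 * b * (2 * n ^ 2 * b) ^ (n - 1) : ℕ) : ℤ) := by
    intro l
    refine le_trans ?_ (hNb l)
    rw [Fintype.card_fin]
    push_cast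
    calc (2 * (n : ℤ) ^ 2 * b) ^ (n - 1 - l) = 1 * (2 * (n : ℤ) ^ 2 * b) ^ (n - 1 - l) := (one_mul _).symm
      _ ≤ (n : ℤ) ^ 2 * b * (2 * (n : ℤ) ^ 2 * b) ^ (n - 1 - l) := mul_le_mul_of_nonneg_right h2 (by positivity)
  refine ⟨fun l i k => ?_, fun l => ?_, fun l hl => ?_⟩
  · have h := (abs_flMat_le B hb hb1 l i k).trans (hK l)
    have : ((flMat B l i k).natAbs : ℤ) < 2 ^ W := (Int.natCast_natAbs _ ▸ h.trans_lt hW')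
    exact_mod_cast this
  · have h := (abs_trace_mul_flMat_le B hb hb1 l).trans (hNb l)
    have : (((B * flMat B l).trace).natAbs : ℤ) < 2 ^ W := (Int.natCast_natAbs _ ▸ h.trans_lt hW')
    exact_mod_cast this
  · have h := (abs_charpoly_coeff_le B hb hb1 (l := l) (by simpa using hl)).trans (hNb l)
    have : ((B.charpoly.coeff l).natAbs : ℤ) < 2 ^ W := (Int.natCast_natAbs _ ▸ h.trans_lt hW')
    exact_mod_cast this

/-- **One round advances the invariant**: for `j < n`, the body maps the state after `j` rounds to the
state after `j + 1` rounds (Faddeev–LeVerrier: `N_l = B N_{l+1} + c_{l+1} 1`, `c_l = −tr(B N_l)/(n − l)`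
with `l = n − j − 1`; no saturation under `WidthOK`). [cite: Altac2024, §11.8 eq. (11.104)] -/
theorem flBody_loopState (x : List Bool) {n : ℕ} (hn : n ≤ x.length) (B : Matrix (Fin n) (Fin n) ℤ)
    (hW : WidthOK x.length B) (cnt : List Bool) {j : ℕ} (hj : j < n) :
    flBody (boolPair x (boolPair cnt (loopState B j))) = loopState B (j + 1) := by
  rw [loopState, flBody_apply x hn B cnt (r := j + 1) (by omega), loopState]
  set l := n - (j + 1) with hl
  have hl' : n - j = l + 1 := by omega
  have hT : stepRows x.length B (B.charpoly.coeff (n - j)) (fun k i : Fin n => flMat B (n - j) i k) =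
      fun k i : Fin n => flMat B l i k := by
    funext k i
    have hrec : flMat B l i k = ∑ t, B i t * flMat B (l + 1) t k + B.charpoly.coeff (l + 1) * (if i = k then 1 else 0) := by
      rw [flMat_eq_mul_add B l, Matrix.add_apply, Matrix.mul_apply, Matrix.smul_apply, Matrix.one_apply, smul_eq_mul]
    have e : (∑ t, flMat B (l + 1) t k * B i t + if k = i then B.charpoly.coeff (l + 1) else 0) = flMat B l i k := by
      rw [hrec]
      congr 1
      · exact Finset.sum_congr rfl fun t _ => mul_comm _ _
      · by_cases h : k = i
        · subst h; simp
        · rw [if_neg h, if_neg (Ne.symm h), mul_zero]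
    rw [stepRows, hl', e]
    exact capZ_of_lt (hW.flMat_lt l i k)
  rw [hT]
  have htr : (∑ i, ∑ t, B i t * flMat B l t i) = (B * flMat B l).trace := by
    simp only [Matrix.trace, Matrix.diag, Matrix.mul_apply]
  have hln : l < Fintype.card (Fin n) := by rw [Fintype.card_fin]; omega
  have hcoef : -(B * flMat B l).trace / ((j + 1 : ℕ) : ℤ) = B.charpoly.coeff l := by
    rw [charpoly_coeff_eq_neg_trace_div B hln, Fintype.card_fin, show n - l = j + 1 by omega]
  have hc : newCoef x.length B (j + 1) (fun k i : Fin n => flMat B l i k) = B.charpoly.coeff l := by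
    rw [newCoef, htr, capZ_of_lt (hW.trace_lt l), hcoef, capZ_of_lt (hW.coeff_lt l (by omega))]
  rw [hc]

/-- **The invariant of the loop**: `m` further rounds from the state after `n − m` rounds reach the state
after `n` rounds. [folklore] -/
theorem loopModel_loopState (x : List Bool) {n : ℕ} (hn : n ≤ x.length) (B : Matrix (Fin n) (Fin n) ℤ)
    (hW : WidthOK x.length B) : ∀ m, m ≤ n → loopModel flBody x m (loopState B (n - m)) = loopState B n
  | 0, _ => by simp [loopModel]
  | m + 1, hm => by
    rw [loopModel, flBody_loopState x hn B hW _ (by omega), show n - (m + 1) + 1 = n - m by omega]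
    exact loopModel_loopState x hn B hW m (by omega)

/-- The initial state is the state after `0` rounds: `N_n = 0`, `c_n = 1`. [folklore] -/
theorem loopState_zero {n : ℕ} (B : Matrix (Fin n) (Fin n) ℤ) :
    loopState B 0 = boolPair (boolPair (encodeNat n) (boolPair (matCode (fun i j => B i j)) (idxList n)))
      (boolPair (encodeNat 1) (boolPair (dpEnc 1) (matCode (fun _ _ : Fin n => (0 : ℤ))))) := by
  rw [loopState, Nat.sub_zero, show B.charpoly.coeff n = 1 by simpa using charpoly_coeff_card B,
    flMat_of_card_le B (by simp)]
  rfl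

/-! ### The machine -/

/-- The index list `idxList n` from `v = ⟨x, ⟨nn, M⟩⟩`. [folklore] -/
def idxOfF : List Bool → List Bool := iotaF ∘ fanoutFn fstF (nthF 1)

/-- `idxOfF ∈ FP`. [folklore] -/
theorem idxOfF_mem_FP : idxOfF ∈ FP := comp_mem_FP iotaF_mem_FP (fanoutFn_mem_FP fstF_mem_FP (nthF_mem_FP 1))

/-- The initial loop record `⟨x, ⟨nn, ⟨⟨nn, ⟨M, idx⟩⟩, ⟨bin 1, ⟨dpEnc 1, matCode 0⟩⟩⟩⟩⟩` from `v = ⟨x, ⟨nn, M⟩⟩`.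
[folklore] -/
def initF : List Bool → List Bool :=
  fanoutFn fstF (fanoutFn (nthF 1) (fanoutFn (fanoutFn (nthF 1) (fanoutFn (sndPow 1) idxOfF))
    (fanoutFn (fun _ => encodeNat 1) (fanoutFn (fun _ => dpEnc 1) (zeroMatF ∘ fanoutFn fstF (fanoutFn (nthF 1) idxOfF))))))

/-- `initF ∈ FP`. [folklore] -/
theorem initF_mem_FP : initF ∈ FP :=
  fanoutFn_mem_FP fstF_mem_FP (fanoutFn_mem_FP (nthF_mem_FP 1) (fanoutFn_mem_FP (fanoutFn_mem_FP (nthF_mem_FP 1)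
    (fanoutFn_mem_FP (sndPow_mem_FP 1) idxOfF_mem_FP))
    (fanoutFn_mem_FP (const_mem_FP _) (fanoutFn_mem_FP (const_mem_FP _) (comp_mem_FP zeroMatF_mem_FP
      (fanoutFn_mem_FP fstF_mem_FP (fanoutFn_mem_FP (nthF_mem_FP 1) idxOfF_mem_FP)))))))

/-- Semantics of `initF` (`n ≤ |x|`). [folklore] -/
theorem initF_apply (x : List Bool) {n : ℕ} (hn : n ≤ x.length) (B : Matrix (Fin n) (Fin n) ℤ) :
    initF (boolPair x (boolPair (encodeNat n) (matCode (fun i j => B i j)))) =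
      boolPair x (boolPair (encodeNat n) (loopState B 0)) := by
  have hidx : idxOfF (boolPair x (boolPair (encodeNat n) (matCode (fun i j => B i j)))) = idxList n := by
    simp only [idxOfF, Function.comp_apply, fanoutFn_apply, fstF_boolPair, nthF_succ_boolPair, nthF_zero_boolPair]
    exact iotaF_apply x hn
  rw [loopState_zero]
  simp only [initF, fanoutFn_apply, fstF_boolPair, nthF_succ_boolPair, nthF_zero_boolPair, sndPow_succ_boolPair, sndPow_zero,
    sndF_boolPair, Function.comp_apply, hidx, zeroMatF_apply x hn]

/-- **The Faddeev–LeVerrier machine** on `⟨x, ⟨bin n, matCode B⟩⟩`: run the loop `n` times from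
`⟨1, 1, 0⟩` and return the last two state fields `⟨c, T⟩`. [cite: Altac2024, §11.8 eq. (11.104)–(11.106)] -/
def adjNegF : List Bool → List Bool := sndPow 3 ∘ loopX flBody ∘ initF

/-- **`adjNegF ∈ FP`.** [cite: AroraBarak2009, §1.3] -/
theorem adjNegF_mem_FP : adjNegF ∈ FP :=
  comp_mem_FP (sndPow_mem_FP 3) (comp_mem_FP (loopX_mem_FP flBody_mem_FP length_flBody_le) initF_mem_FP)

/-- **Semantics of the Faddeev–LeVerrier machine**: on the code of an `n × n` integer matrix `B` with
`n ≤ |x|` and registers wide enough (`WidthOK`, e.g. `n² b (2n²b)^{n-1} < 2^{|x|}` for `|B i j| ≤ b`,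
`widthOK_of_bound`), `adjNegF ⟨x, ⟨bin n, matCode B⟩⟩ = ⟨dpEnc (det (−B)), matCode (adj (−B))ᵀ⟩`.
[cite: Altac2024, §11.8 eq. (11.104)–(11.106)] -/
theorem adjNegF_apply (x : List Bool) {n : ℕ} (hn : n ≤ x.length) (B : Matrix (Fin n) (Fin n) ℤ) (hW : WidthOK x.length B) :
    adjNegF (boolPair x (boolPair (encodeNat n) (matCode (fun i j => B i j)))) =
      boolPair (dpEnc (-B).det) (matCode (fun k i : Fin n => (-B).adjugate i k)) := by
  rw [adjNegF, Function.comp_apply, Function.comp_apply, initF_apply x hn B, loopX_apply _ _ _ hn]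
  have h := loopModel_loopState x hn B hW n le_rfl
  rw [Nat.sub_self] at h
  rw [h, loopState]
  simp only [sndPow_succ_boolPair, sndPow_zero, sndF_boolPair, Nat.sub_self]
  rw [charpoly_coeff_zero_eq_det_neg, adjugate_neg_eq_flMat_zero]

/-- The same from an explicit entry bound. [cite: Altac2024, §11.8 eq. (11.104)–(11.106)] -/
theorem adjNegF_apply_of_bound (x : List Bool) {n b : ℕ} (hn : n ≤ x.length) (B : Matrix (Fin n) (Fin n) ℤ)
    (hb : ∀ i j, |B i j| ≤ b) (hb1 : 1 ≤ b) (hW : n ^ 2 * b * (2 * n ^ 2 * b) ^ (n - 1) < 2 ^ x.length) :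
    adjNegF (boolPair x (boolPair (encodeNat n) (matCode (fun i j => B i j)))) =
      boolPair (dpEnc (-B).det) (matCode (fun k i : Fin n => (-B).adjugate i k)) :=
  adjNegF_apply x hn B (widthOK_of_bound B hb hb1 hW)

/-- **What the output is good for**: `B · (−adj(−B)) = det(−B) · 1` (so `C = −adj(−B)`, `D = det(−B)` is an
admissible pair for the integer certificates of `ARVerifier.lean`), and `det(−B) ≠ 0` iff `det B ≠ 0`.
[folklore] -/
theorem mul_neg_adjugate_neg {n : ℕ} (B : Matrix (Fin n) (Fin n) ℤ) :
    B * (-(-B).adjugate) = (-B).det • (1 : Matrix (Fin n) (Fin n) ℤ) := by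
  rw [Matrix.mul_neg, ← Matrix.neg_mul, Matrix.mul_adjugate]

/-- `det(−B) ≠ 0 ↔ det B ≠ 0`. [folklore] -/
theorem det_neg_ne_zero_iff {n : ℕ} (B : Matrix (Fin n) (Fin n) ℤ) : (-B).det ≠ 0 ↔ B.det ≠ 0 := by
  rw [Matrix.det_neg]
  simp


end AdjMachine

end Literature.Algebra.EuclideanLattices

end
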